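import Literature.Combinatorics.Enumerative.HafnianGeneratingFunction
import Literature.MathematicalPhysics.QuantumFieldTheory.Balaban1983to89.HiggsFluctMeasureWickPairingSum
import HarnessLib

/-!
# The hafnian IS the Wick pairing sum: `Haf((C_{ab})_{a,b∈s}) = wickSum C s = fsPairing C s`, `Haf((S(x_i,x_j))_{ij}) = 𝒢_k[S](x)`,
# and `#perfectMatchings = #pairPartitions`

Topic `Literature/Combinatorics/Enumerative`, sequel of `Hafnian.lean` ∕ `HafnianExpansion.lean` ∕ `HafnianGeneratingFunction.lean`
(the hafnian `Haf A = Σ_{τ fixed-point-free involution} Π_{v<τv} A v (τ v)` of the combinatorics shelf, with Barvinok's row expansion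
(4.3.1) `hafnian_subMat_eq_sum`) and BRIDGE to the Gaussian∕Wick shelf of the tree, which carries THREE pairing functionals already proved
equal to each other in `Literature/MathematicalPhysics/QuantumFieldTheory/Balaban1983to89/HiggsFluctMeasureWickPairingSum.lean`:
`HiggsFluctMeasureWickSum.wickSum C s` (least-leg recursion, [Balaban1983Higgs3] p.414 «divided into pairs»),
`Literature.Probability.LatticeModels.fsPairing` (the same recursion) and `Literature.Probability.LatticeModels.pairingSum` (`𝒢_k`, the
average over orderings; the currency of `Literature/Probability/Distributions/GaussianWickTheorem`), all equal to the literal sum over the pair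
partitions `Σ_{π ∈ pairPartitions s} Π_{B∈π} pairVal C B` (Janson's Theorem 1.28 as printed).  This file proves that the FOURTH currency,
the hafnian, is the same number:

* **`wickSum_eq_hafnian_subMat`** — for a symmetric propagator `C` and every finite set of legs `s`,
  `wickSum C s = Haf((C a b)_{a,b∈s})` (the two first-leg recursions coincide: `wickSum_of_nonempty` at the least leg is Barvinok's
  (4.3.1) `hafnian_subMat_eq_sum` at that leg; strong induction on `|s|`); `wickSum_univ_eq_hafnian` (all legs of a finite type);
* the transports **`fsPairing_eq_hafnian_subMat`**, **`pairingSum_eq_hafnian`** (`𝒢_k[S](x) = Haf((S(x_i,x_j))_{i,j<2k})`),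
  **`sum_pairPartitions_pairVal_eq_hafnian_subMat`** (Janson's printed sum over pair partitions is the hafnian);
* **`card_perfectMatchings_coe_eq_card_pairPartitions`** — the two encodings of «perfect matching» in the tree (fixed-point-free involutions of
  `↥s` in `Hafnian.lean`, sets of disjoint pairs covering `s` in `HiggsFluctMeasureWickPairings`) have the same number of elements.

Consequently every Wick∕Isserlis theorem of the tree stated with `wickSum` ∕ `fsPairing` ∕ `pairingSum` ∕ `pairPartitions`
(`GaussianWick.integral_prod_eq_pairingSum`, `HiggsFluctMeasureWickPairingSum.integral_prod_eq_wickSum`, `…integral_prod_eval_eq_wickSum`,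
`…integral_prod_linF_eq_wickSum`, …) can be read with the hafnian and conversely (e.g. the Summits-side King-model rung files
`…N15KingModelIsserlisHafnian` ∕ `…GaussianFieldWick`, which prove Isserlis' theorem directly in the hafnian currency, are thereby consistent with them),
and every hafnian theorem (`card_perfectMatchings`, `hafnian_smul`, `hafnian_bipartiteDouble = permanent`, the expansions) applies to the pairing sums.

Sources: A. Barvinok, *Approximating permanents and hafnians*, Discrete Analysis 2017:2, §2.1 («the sum is taken over all unordered partitions of
the set `{1, …, 2n}` into `n` pairwise disjoint unordered pairs») and §4.3 (4.3.1) [BarvinokDA2017]; S. Janson, *Gaussian Hilbert Spaces* (1997)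
Thm 1.28 (1.2) [Janson1997]; J. Glimm, A. Jaffe, *Quantum Physics* §8.2 (8.2.4) [GlimmJaffeQP1987].  All statements here are classical
combinatorics; nothing is claimed about any physical model.  0 `sorry`, 0 def.
-/

namespace Literature.Combinatorics.Enumerative

open Finset
open Literature.MathematicalPhysics.QuantumFieldTheory.Balaban1983to89.HiggsFluctMeasureWickSum (wickSum wickSum_empty wickSum_of_nonempty)
open Literature.MathematicalPhysics.QuantumFieldTheory.Balaban1983to89.HiggsFluctMeasureWickPairings (pairPartitions pairVal
  wickSum_eq_sum_pairPartitions_pairVal card_pairPartitions_eq_wickSum_one)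
open Literature.MathematicalPhysics.QuantumFieldTheory.Balaban1983to89.HiggsFluctMeasureWickPairingSum (pairingSum_eq_wickSum
  wickSum_eq_fsPairing)
open Literature.Probability.LatticeModels (pairingSum fsPairing)
open HafnianGeneratingFunction (subMat hafnian_subMat_eq_sum hafnian_subMat_empty hafnian_submatrix_equiv)

namespace HafnianWickSum

variable {ι : Type*} [LinearOrder ι]

omit [LinearOrder ι] in
/-- A symmetric propagator gives a symmetric matrix. [folklore] -/
private theorem isSymm_of (C : ι → ι → ℝ) (hC : ∀ a b, C a b = C b a) : (Matrix.of fun a b : ι => C a b).IsSymm :=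
  Matrix.IsSymm.ext fun a b => hC b a

/-- **THE HAFNIAN IS THE WICK PAIRING SUM**: for a symmetric propagator `C` and every finite set of legs `s`,
`wickSum C s = Haf((C a b)_{a,b∈s})` — «the sum … over all unordered partitions of the set into pairwise disjoint unordered pairs»; the least-leg
recursion defining `wickSum` is Barvinok's row expansion (4.3.1) of the hafnian along that leg.
[cite: BarvinokDA2017, §2.1 and §4.3 eq. (4.3.1)] -/
theorem wickSum_eq_hafnian_subMat (C : ι → ι → ℝ) (hC : ∀ a b, C a b = C b a) (s : Finset ι) :
    wickSum C s = hafnian (subMat (Matrix.of fun a b : ι => C a b) s) := by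
  induction s using Finset.strongInduction with
  | H s ih =>
    by_cases h : s.Nonempty
    · rw [wickSum_of_nonempty C h, hafnian_subMat_eq_sum _ (isSymm_of C hC) (Finset.min'_mem s h)]
      refine Finset.sum_congr rfl fun i _ => ?_
      rw [Matrix.of_apply, ih _ ((Finset.erase_subset i _).trans_ssubset (Finset.erase_ssubset (Finset.min'_mem s h)))]
    · rw [Finset.not_nonempty_iff_eq_empty.mp h, wickSum_empty, hafnian_subMat_empty]

/-- All legs of a finite type: `wickSum C univ = Haf(C)`. [cite: BarvinokDA2017, §2.1] -/
theorem wickSum_univ_eq_hafnian [Fintype ι] (C : ι → ι → ℝ) (hC : ∀ a b, C a b = C b a) :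
    wickSum C univ = hafnian (Matrix.of fun a b : ι => C a b) := by
  rw [wickSum_eq_hafnian_subMat C hC univ]
  exact hafnian_submatrix_equiv (Equiv.subtypeUnivEquiv Finset.mem_univ) (fun _ _ h => h) _

/-- The `LatticeModels` subset-indexed pairing functional is the hafnian: `fsPairing C s = Haf((C a b)_{a,b∈s})`.
[cite: BarvinokDA2017, §2.1] -/
theorem fsPairing_eq_hafnian_subMat (C : ι → ι → ℝ) (hC : ∀ a b, C a b = C b a) (s : Finset ι) :
    fsPairing C s = hafnian (subMat (Matrix.of fun a b : ι => C a b) s) := by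
  rw [← wickSum_eq_fsPairing, wickSum_eq_hafnian_subMat C hC s]

/-- **Janson's printed pairing sum is the hafnian**: `Σ_{π ∈ pairPartitions s} Π_{B∈π} pairVal C B = Haf((C a b)_{a,b∈s})` (`C` symmetric).
[cite: Janson1997, Thm 1.28 (1.2)] -/
theorem sum_pairPartitions_pairVal_eq_hafnian_subMat (C : ι → ι → ℝ) (hC : ∀ a b, C a b = C b a) (s : Finset ι) :
    ∑ π ∈ pairPartitions s, ∏ B ∈ π, pairVal C B = hafnian (subMat (Matrix.of fun a b : ι => C a b) s) := by
  rw [← wickSum_eq_sum_pairPartitions_pairVal, wickSum_eq_hafnian_subMat C hC s]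

/-- **The ordering-average functional `𝒢_k` is the hafnian**: for a symmetric kernel `S` and points `x : Fin (2k) → α`,
`pairingSum S k x = Haf((S(x_i,x_j))_{i,j<2k})` — the currency of `GaussianWickTheorem` read on the combinatorics shelf.
[cite: GlimmJaffeQP1987, (8.2.4) §8.2] -/
theorem pairingSum_eq_hafnian {α : Type*} (S : α → α → ℝ) (hS : ∀ a b, S a b = S b a) (k : ℕ) (x : Fin (2 * k) → α) :
    pairingSum S k x = hafnian (Matrix.of fun i j : Fin (2 * k) => S (x i) (x j)) := by
  rw [pairingSum_eq_wickSum S hS k x]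
  exact wickSum_univ_eq_hafnian (fun i j => S (x i) (x j)) fun a b => hS _ _

omit [LinearOrder ι] in
/-- The all-ones propagator on `s`: its `(0,1)` «adjacency matrix of the complete graph» on `↥s` is the constant submatrix `1`. [folklore] -/
private theorem adjMatrix01_true_eq_subMat_one (s : Finset ι) :
    (adjMatrix01 (fun _ _ : s => True) : Matrix s s ℝ) = subMat (Matrix.of fun _ _ : ι => (1 : ℝ)) s := by
  ext a b
  simp [adjMatrix01]

/-- **THE TWO ENCODINGS OF «PERFECT MATCHING» IN THE TREE AGREE IN NUMBER**: the fixed-point-free involutions of `↥s` (`Hafnian.lean`) are as many as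
the sets of disjoint pairs covering `s` (`HiggsFluctMeasureWickPairings.pairPartitions`) — both count `Haf(𝟙) = wickSum 1 s`.
[cite: BarvinokDA2017, §2.1] -/
theorem card_perfectMatchings_coe_eq_card_pairPartitions (s : Finset ι) :
    (perfectMatchings (s : Type _)).card = (pairPartitions s).card := by
  have h1 : ((pairPartitions s).card : ℝ) = hafnian (subMat (Matrix.of fun _ _ : ι => (1 : ℝ)) s) := by
    rw [card_pairPartitions_eq_wickSum_one, wickSum_eq_hafnian_subMat _ (fun _ _ => rfl)]
  have h2 : hafnian (subMat (Matrix.of fun _ _ : ι => (1 : ℝ)) s) = ((perfectMatchings (s : Type _)).card : ℝ) := by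
    rw [← adjMatrix01_true_eq_subMat_one, hafnian_adjMatrix01 _ (fun _ _ _ => trivial)]
    congr 2
    exact Finset.filter_true_of_mem fun τ _ v => trivial
  exact_mod_cast (h1.trans h2).symm

end HafnianWickSum

end Literature.Combinatorics.Enumerative
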